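import Summits.QuantumFields.QCD.Theorems.NestedDissectionSeaRobustYangMillsLocalAC
import Literature.Probability.LatticeModels.CoarseCellFiniteSize
import Literature.Probability.LatticeModels.ZModTorusFrames
import Literature.MathematicalPhysics.QuantumFieldTheory.QuasiLocalGaugePerturbationCovariance
import Literature.MathematicalPhysics.QuantumFieldTheory.QuasiLocalGaugePerturbationCells
import Literature.MathematicalPhysics.QuantumFieldTheory.BlockCellGeometry

/-!
# Line `local-ac-open-certificate` for the crux `RobustYangMills` (stmt-QuantumFields-13897) —
# vocabulary §2–§3 and the CLOSED stub `stub_deployment` (lead's reshape r2)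

Crux: `Summit.QuantumFields.QCD.Theses.NestedDissectionSea.RobustYangMills` (shared verbatim with
`HeavyThresholdYMBridge` / `AdaptiveBlockFermions`); checked skeleton
`Cruxes/RobustYangMills/Lines/local-ac-open-certificate.lean`; base module (§0–§1, `stub_localAC`)
`NestedDissectionSeaRobustYangMillsLocalAC`. This module carries, verbatim from the skeleton (docstrings
shortened), the remaining line vocabulary — `PerturbedMixingEngine` (statement of `stub_mixingEngine`),
`WilsonGoodCertificate` (statement of `stub_wilsonCertificate`), `IRConeClustering` (with the (h1)
translation-invariance binder of reshape r2) and `Deployment` — over the Literature vocabulary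
`CoarseCellFiniteSize` (coarse cells, finite-size conditions), `ZModTorusFrames` (`IsTorusFrame`,
the explicit frames `axisFrame`), `BlockCellGeometry` (`siteCell`, `cellOf`, `prodFrame`, blocks
versus cells), `QuasiLocalGaugePerturbationCells` (the DLR kernels through cells) and
`QuasiLocalGaugePerturbationCovariance` (`covCorr`, translation invariance); and it proves
`stub_deployment : Deployment`.

**Proof of the deployment** (frames + counting + `∀ᶠ` bookkeeping; constants existential). Given the
toolkit, the engine and the certificate: take the certificate's window `n`, the engine's thresholds
`p₀(n), ε₁(n)`, the certificate's `(ε₀, c₁)` at rarity `p₀`, and for `κ > 0` the engine's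
`(Λ₀, κₑ, C₀)` at leak rate `r = κ`; put `η₁ = min(ε₁/(2·10⁴), log(1+Λ₀)/(4·10⁴(4n+1)⁴))`. In the IR
regime `Λ'ℓ₀ ≥ c₁`, eventually in `k` (`a_k ≤ min 1 ℓ₀`, `(4n+3)(2ℓ₀+1) ≤ a_k L_k`, the certificate at
cell scale `C = 2Λ'ℓ₀`), on the torus `2S+1 ≥ 2L_k+1`: block scale `b = ⌊ℓ₀/a_k⌋ ≥ 1`, frame scale
`b' = ⌈2ℓ₀/a_k⌉ ∈ [2b, 4b]`, `μ + 1 = (2S+1)/b' ≥ 4n+3` cells per axis (`level_numerics`); the explicit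
product frame is a torus frame (`isTorusFrame_axisFrame`), so the certificate gives good sets, the
good-exterior condition for Wilson's kernels and Peierls rarity under `wilsonMeasure`; the Literature
corollaries of the toolkit give `IsLocallyAC` of `γ^{β,w}` w.r.t. Wilson at rate `2·10⁴ η₁ ≤ ε₁`
and the leak profile `e^{4η₁10⁴(4n+1)⁴} - 1 ≤ Λ₀` at rate `κ` (none for Wilson); DLR is toolkit (c).
The engine then bounds covariances of cell-local observables under `μ_{β,w}`; the two species read
through `torusLift` (and `τ_t`) are cell-local on `≤ |supp|` cells at cell distance
`≥ t/(2b') - δ₀ - 1` (`le_cdist_cellOf_torusEdge_timeShift`, no wrap-around for `t ≤ S`), and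
`2b' a_k ≤ 6ℓ₀` turns `e^{-κₑ D}` into `e^{κₑ(δ₀+2)} e^{-(κₑ/6ℓ₀) a_k t}` (`level_bound`). Finally, for
`w` with translation-invariant total, D1's `connectedCorr` is that covariance
(`connectedCorr_eq_covCorr`). Output: `c₁ = c₁(p₀(n))`, `η₁(κ)` as above, `Δ = κₑ/(6ℓ₀)`.

Sources: Georgii (2011) Rem. 1.24, Ch. 8; Osterwalder–Seiler, Ann. Phys. 110 (1978) §2; Seiler, LNP
159 (1982) Ch. 2; Dobrushin–Shlosman (1985) §2.
-/

set_option autoImplicit false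

noncomputable section

namespace Summit.QuantumFields.QCD.Cruxes.RobustYangMills.LocalAcOpenCertificate

open scoped BigOperators Topology ENNReal
open Filter MeasureTheory
open Literature.MathematicalPhysics.QuantumLattice Literature.MathematicalPhysics.AQFT
  Literature.MathematicalPhysics.QuantumFieldTheory
open Literature.Probability.LatticeModels (CoarseIdx cdist shellCount cellCount IsGoodFS HasLeak IsLocallyAC
  PeierlsRare IsTorusFrame isTorusFrame_axisFrame Specification IsSpecification IsGibbsMeasure)

/-! ## §2 The perturbed-mixing engine (statement of `stub_mixingEngine`) -/

/-- **The perturbed-mixing engine** (statement of `stub_mixingEngine`; classical probability, `G`-blind): covariance decay `C₀ B_f B_g |Δf| |Δg| e^{-κₑ D}` for every Gibbs measure of a specification locally a.c. (rate `ε₁(n)`) w.r.t. a reference satisfying the good-exterior finite-size condition `(n, ε₀)`, both with leak profile `(Λl ≤ Λ₀, r)`, bad cells Peierls-rare (`p ≤ p₀(n)`) under the reference Gibbs measure, on coarse tori with `≥ 4n+3` cells per axis. -/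
def PerturbedMixingEngine : Prop :=
  ∀ n : ℕ, 1 ≤ n → ∃ p₀ ε₁ : ℝ, 0 < p₀ ∧ 0 < ε₁ ∧
    ∀ (ε₀ r : ℝ), 0 ≤ ε₀ → 2 * ε₀ * (shellCount 4 n : ℝ) ≤ 1 → 0 < r →
    ∃ Λ₀ κₑ C₀ : ℝ, 0 < Λ₀ ∧ 0 < κₑ ∧ 0 ≤ C₀ ∧
    ∀ (μc : Fin 4 → ℕ) (V S : Type) [Fintype V] [MeasurableSpace S] (cell : V → CoarseIdx μc)
      (γ₀ γ : Specification V S) (good : CoarseIdx μc → Set (V → S)) (ν₀ ν : Measure (V → S))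
      (p Λl : ℝ),
      (∀ i, 4 * n + 3 ≤ μc i + 1) → IsSpecification γ₀ → IsSpecification γ →
      IsGibbsMeasure γ₀ ν₀ → IsGibbsMeasure γ ν →
      IsGoodFS cell γ₀ good n ε₀ → 0 ≤ Λl → Λl ≤ Λ₀ → HasLeak cell γ₀ n Λl r → HasLeak cell γ n Λl r →
      IsLocallyAC cell γ γ₀ ε₁ → 0 ≤ p → p ≤ p₀ → PeierlsRare good ν₀ p →
      ∀ (f g : (V → S) → ℝ) (Δf Δg : Finset (CoarseIdx μc)) (Bf Bg : ℝ) (D : ℕ),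
        Measurable f → Measurable g → (∀ σ, |f σ| ≤ Bf) → (∀ σ, |g σ| ≤ Bg) →
        DependsOn f {v | cell v ∈ Δf} → DependsOn g {v | cell v ∈ Δg} →
        (∀ x ∈ Δf, ∀ y ∈ Δg, D ≤ cdist x y) →
          |∫ σ, f σ * g σ ∂ν - (∫ σ, f σ ∂ν) * ∫ σ, g σ ∂ν| ≤
            C₀ * Bf * Bg * Δf.card * Δg.card * Real.exp (-(κₑ * D))

/-! ## §3 The Wilson good-cube certificate (statement of `stub_wilsonCertificate`), IR clustering of
the cone, deployment (statement of `stub_deployment`) -/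

/-- **The SU(3) Wilson GOOD-CUBE CERTIFICATE along asymptotically free sequences** (statement of `stub_wilsonCertificate`; W-free, YM-hard — THE BET): a window `n ≥ 1` such that for every rarity `p > 0` there are `ε₀` (`2ε₀ · shellCount ≤ 1`) and a physical scale `c₁ > 0` with: for all scaling / a.f. data and cell scales `C ≥ c₁`, eventually in `k`, on every odd torus and every family of axis frames of scale `⌈C/(Λ'a_k)⌉` with `≥ 4n+3` cells per axis, cell-local measurable GOOD sets for which Wilson's kernels satisfy the good-exterior condition `(n, ε₀)` and bad cells are Peierls-rare with ratio `p` under Wilson's measure. -/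
def WilsonGoodCertificate : Prop :=
  ∃ n : ℕ, 1 ≤ n ∧ ∀ p : ℝ, 0 < p → ∃ ε₀ c₁ : ℝ, 0 ≤ ε₀ ∧ 2 * ε₀ * (shellCount 4 n : ℝ) ≤ 1 ∧ 0 < c₁ ∧
    ∀ (a : ℕ → ℝ), (∀ k, 0 < a k) → Tendsto a atTop (𝓝 0) →
    ∀ (β' : ℕ → ℝ) (Λ' : ℝ), 0 < Λ' → Tendsto (fun k => β' k - afBeta 0 Λ' (a k)) atTop (𝓝 0) →
    ∀ C : ℝ, c₁ ≤ C →
    ∀ᶠ k in atTop, ∀ (S : ℕ) (μc : Fin 4 → ℕ) (q : (i : Fin 4) → ZMod (2 * S + 1) → ZMod (μc i + 1)),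
      (∀ i, 4 * n + 3 ≤ μc i + 1) → (∀ i, IsTorusFrame (2 * S + 1) ⌈C / (Λ' * a k)⌉₊ (q i)) →
      ∃ good : CoarseIdx μc → Set (GaugeConfig 4 (2 * S + 1) SU3),
        IsGoodFS (cellOf q) (wilsonSpec (Lt := 2 * S + 1) ρ₃ (β' k)) good n ε₀ ∧
        PeierlsRare good (wilsonMeasure (d := 4) (L := 2 * S + 1) ρ₃ (β' k)) p

/-- **Uniform IR clustering of the sup-small, range-controlled, translation-invariant cone** (the line's own deliverable; reshape r2: D1's `connectedCorr` is a covariance only for translation-invariant `μ_{β,w}`, hence the (h1) binder): with budget `η₁` and rate `κ`, for all scaling data, every a.f. sequence and every block scale in the IR regime `Λ'ℓ₀ ≥ c₁` there is `Δ > 0` with, for every species pair, a constant `C` such that for all large `k`, on every torus `S ≥ L_k`, for every `w` of the cone, `|⟨A; τ_t B⟩_{β'_k,w}| ≤ C e^{-Δ a_k t}` for `t ≤ S`. -/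
def IRConeClustering (η₁ κ c₁ : ℝ) : Prop :=
  ∀ (a : ℕ → ℝ) (L : ℕ → ℕ), (∀ k, 0 < a k) → Tendsto a atTop (𝓝 0) →
    Tendsto (fun k => a k * L k) atTop atTop →
  ∀ (β' : ℕ → ℝ) (Λ' : ℝ), 0 < Λ' → Tendsto (fun k => β' k - afBeta 0 Λ' (a k)) atTop (𝓝 0) →
  ∀ ℓ₀ : ℝ, c₁ ≤ Λ' * ℓ₀ →
    ∃ Δ : ℝ, 0 < Δ ∧ ∀ A B : YMSpecies SU3, ∃ C : ℝ, ∀ᶠ k in atTop, ∀ S : ℕ, L k ≤ S →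
      ∀ w : QuasiLocalGaugePerturbation 4 (2 * S + 1) SU3 ⌊ℓ₀ / a k⌋₊,
        w.NormLE κ η₁ → RangeControl w →
        (∀ (v : Site 4 (2 * S + 1)) (U : GaugeConfig 4 (2 * S + 1) SU3),
          w.total (torusConfigShift v U) = w.total U) →
        ∀ t : ℕ, t ≤ S →
          |w.connectedCorr ρ₃ (β' k) A.F B.F t| ≤ C * Real.exp (-(Δ * (a k * t)))

/-- **Deployment on the symmetric torus** (statement of `stub_deployment`): toolkit + engine + certificate give uniform IR clustering of the cone for EVERY decay rate `κ > 0`, with a budget `η₁(κ) > 0` and the certificate's scale `c₁`. -/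
def Deployment : Prop :=
  LocalACToolkit → PerturbedMixingEngine → WilsonGoodCertificate →
    ∃ c₁ : ℝ, 0 < c₁ ∧ ∀ κ : ℝ, 0 < κ → ∃ η₁ : ℝ, 0 < η₁ ∧ IRConeClustering η₁ κ c₁

/-! ## Proof of `stub_deployment` -/

section Proof

/-- **Level numerics**: for `a ≤ min 1 ℓ₀`, `(4n+3)(2ℓ₀+1) ≤ a L_k` and `S ≥ L_k`, the block scale
`b = ⌊ℓ₀/a⌋`, the frame scale `b' = ⌈2ℓ₀/a⌉` and `μ + 1 = (2S+1)/b'` cells per axis satisfy every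
arithmetic side condition of the level bound. -/
theorem level_numerics {a ℓ₀ : ℝ} {Lk S n : ℕ} (ha : 0 < a) (ha1 : a ≤ 1) (haℓ : a ≤ ℓ₀)
    (hM : (4 * n + 3) * (2 * ℓ₀ + 1) ≤ a * Lk) (hS : Lk ≤ S) :
    1 ≤ ⌊ℓ₀ / a⌋₊ ∧ 0 < ⌈2 * ℓ₀ / a⌉₊ ∧ ⌈2 * ℓ₀ / a⌉₊ ≤ 4 * ⌊ℓ₀ / a⌋₊ ∧
      2 * ⌊ℓ₀ / a⌋₊ ≤ ⌈2 * ℓ₀ / a⌉₊ ∧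
      ((2 * S + 1) / ⌈2 * ℓ₀ / a⌉₊ - 1) * ⌈2 * ℓ₀ / a⌉₊ + ⌈2 * ℓ₀ / a⌉₊ ≤ 2 * S + 1 ∧
      2 * S + 1 < ((2 * S + 1) / ⌈2 * ℓ₀ / a⌉₊ - 1) * ⌈2 * ℓ₀ / a⌉₊ + 2 * ⌈2 * ℓ₀ / a⌉₊ ∧
      4 * n + 3 ≤ (2 * S + 1) / ⌈2 * ℓ₀ / a⌉₊ - 1 + 1 ∧
      (2 * ⌈2 * ℓ₀ / a⌉₊ : ℝ) * a ≤ 6 * ℓ₀ := by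
  set b := ⌊ℓ₀ / a⌋₊ with hb
  set b' := ⌈2 * ℓ₀ / a⌉₊ with hb'
  have hℓ₀ : 0 < ℓ₀ := ha.trans_le haℓ
  have h1b : 1 ≤ b := Nat.floor_pos.2 ((one_le_div ha).2 haℓ)
  have hfl' : ℓ₀ / a < b + 1 := Nat.lt_floor_add_one _
  have hfl : (b : ℝ) ≤ ℓ₀ / a := Nat.floor_le (by positivity)
  have hce : 2 * ℓ₀ / a ≤ b' := Nat.le_ceil _
  have hce' : (b' : ℝ) < 2 * ℓ₀ / a + 1 := Nat.ceil_lt_add_one (by positivity)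
  have h2b : 2 * b ≤ b' := by
    have : (2 * b : ℝ) ≤ b' :=
      calc (2 * b : ℝ) ≤ 2 * (ℓ₀ / a) := by linarith
        _ = 2 * ℓ₀ / a := by ring
        _ ≤ b' := hce
    exact_mod_cast this
  have hb'le : b' ≤ 2 * b + 2 := by
    have h' : (b' : ℝ) < 2 * b + 3 :=
      calc (b' : ℝ) < 2 * ℓ₀ / a + 1 := hce'
        _ = 2 * (ℓ₀ / a) + 1 := by ring
        _ < 2 * (b + 1) + 1 := by linarith
        _ = 2 * b + 3 := by ring
    have : b' < 2 * b + 3 := by exact_mod_cast h'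
    omega
  have hbb : b' ≤ 4 * b := by omega
  have hb'pos : 0 < b' := by omega
  have hkey : (4 * n + 3) * b' ≤ Lk := by
    have h' : ((4 * n + 3) * b' : ℝ) ≤ Lk := by
      have hpos : (0 : ℝ) ≤ 4 * n + 3 := by positivity
      calc ((4 * n + 3) * b' : ℝ) ≤ (4 * n + 3) * (2 * ℓ₀ / a + 1) :=
            mul_le_mul_of_nonneg_left hce'.le hpos
        _ = (4 * n + 3) * (2 * ℓ₀ + a) / a := by field_simp
        _ ≤ (4 * n + 3) * (2 * ℓ₀ + 1) / a := by
            apply div_le_div_of_nonneg_right _ ha.le; nlinarith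
        _ ≤ Lk := by rw [div_le_iff₀ ha]; linarith [hM]
    exact_mod_cast h'
  have hdiv : 4 * n + 3 ≤ (2 * S + 1) / b' :=
    (Nat.le_div_iff_mul_le hb'pos).2 (by nlinarith [hkey, hS])
  set M := (2 * S + 1) / b' with hM'
  have hM1 : 1 ≤ M := le_trans (by omega) hdiv
  obtain ⟨M', hMM'⟩ : ∃ M', M = M' + 1 := ⟨M - 1, (Nat.sub_add_cancel hM1).symm⟩
  have hle : M * b' ≤ 2 * S + 1 := Nat.div_mul_le_self _ _
  have hlt : 2 * S + 1 < M * b' + b' := Nat.lt_div_mul_add hb'pos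
  rw [hMM'] at hle hlt hdiv ⊢
  rw [Nat.add_sub_cancel]
  simp only [Nat.add_mul, Nat.one_mul] at hle hlt
  refine ⟨h1b, hb'pos, hbb, h2b, hle, by omega, hdiv, ?_⟩
  have : (b' : ℝ) * a < 2 * ℓ₀ + a := by
    have := mul_lt_mul_of_pos_right hce' ha
    rwa [add_mul, div_mul_cancel₀ _ ha.ne', one_mul] at this
  nlinarith

/-- The bookkeeping of rates: `e^{-κₑ D} ≤ e^{κₑ(δ₀+2)} e^{-(κₑ/6ℓ₀) a t}` for
`D = t/(2b') - (δ₀+1)` and `2 b' a ≤ 6 ℓ₀`. -/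
theorem final_numeric {κₑ a ℓ₀ : ℝ} {b' t δ₀ : ℕ} (hκₑ : 0 < κₑ) (hℓ₀ : 0 < ℓ₀)
    (hb' : 0 < b') (h6 : (2 * b' : ℝ) * a ≤ 6 * ℓ₀) :
    Real.exp (-(κₑ * ((t / (2 * b') - (δ₀ + 1) : ℕ) : ℝ))) ≤
      Real.exp (κₑ * ((δ₀ + 2 : ℕ) : ℝ)) * Real.exp (-(κₑ / (6 * ℓ₀) * (a * t))) := by
  rw [← Real.exp_add]
  refine Real.exp_le_exp.2 ?_
  set D : ℕ := t / (2 * b') - (δ₀ + 1) with hD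
  have hD1 : t / (2 * b') ≤ D + (δ₀ + 1) := le_tsub_add
  have hD2 : (t : ℝ) < ((t / (2 * b') : ℕ) + 1) * (2 * b' : ℕ) := by
    exact_mod_cast (Nat.lt_div_mul_add (by omega : 0 < 2 * b') : t < t / (2 * b') * (2 * b') + 2 * b')
      |>.trans_eq (by ring)
  have hb2 : (0 : ℝ) < (2 * b' : ℕ) := by exact_mod_cast (by omega : 0 < 2 * b')
  have hD3 : (t : ℝ) / (2 * b' : ℕ) < (t / (2 * b') : ℕ) + 1 := by
    rw [div_lt_iff₀ hb2]; exact hD2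
  have hD1' : ((t / (2 * b') : ℕ) : ℝ) ≤ (D : ℝ) + (δ₀ + 1) := by exact_mod_cast hD1
  have h1 : (t : ℝ) / (2 * b' : ℕ) ≤ D + δ₀ + 2 := by linarith
  have h2 : κₑ / (6 * ℓ₀) * (a * t) ≤ κₑ * ((t : ℝ) / (2 * b' : ℕ)) := by
    rw [div_mul_eq_mul_div, mul_div_assoc]
    refine mul_le_mul_of_nonneg_left ?_ hκₑ.le
    rw [div_le_div_iff₀ (by positivity) hb2]
    push_cast
    nlinarith [Nat.cast_nonneg (α := ℝ) t]
  have h1' := mul_le_mul_of_nonneg_left h1 hκₑ.le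
  push_cast at h1' ⊢
  nlinarith

/-- **One level of the deployment**: a covariance bound of engine type for cell-local observables
under `ν` on the torus `2S+1` (frame scale `b'`, `μ + 1` cells per axis) gives, for two species read
through the periodic lift and the time shift `t ≤ S`, the bound `C_{AB} e^{κₑ(δ₀+2)} e^{-(κₑ/6ℓ₀) a t}`. -/
theorem level_bound {S b' μ : ℕ} {κₑ C₀ a ℓ₀ : ℝ} (hb' : 0 < b') (h2 : 2 * S + 1 < μ * b' + 2 * b')
    (hκₑ : 0 < κₑ) (hC₀ : 0 ≤ C₀) (hℓ₀ : 0 < ℓ₀) (h6 : (2 * b' : ℝ) * a ≤ 6 * ℓ₀)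
    (ν : Measure (GaugeConfig 4 (2 * S + 1) SU3))
    (hcov : ∀ (f g : GaugeConfig 4 (2 * S + 1) SU3 → ℝ)
      (Δf Δg : Finset (CoarseIdx (fun _ : Fin 4 => μ))) (Bf Bg : ℝ) (D : ℕ),
      Measurable f → Measurable g → (∀ σ, |f σ| ≤ Bf) → (∀ σ, |g σ| ≤ Bg) →
      DependsOn f {v | cellOf (prodFrame (2 * S + 1) b' μ) v ∈ Δf} →
      DependsOn g {v | cellOf (prodFrame (2 * S + 1) b' μ) v ∈ Δg} →
      (∀ x ∈ Δf, ∀ y ∈ Δg, D ≤ cdist x y) →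
        |∫ σ, f σ * g σ ∂ν - (∫ σ, f σ ∂ν) * ∫ σ, g σ ∂ν| ≤
          C₀ * Bf * Bg * Δf.card * Δg.card * Real.exp (-(κₑ * D)))
    (A B : YMSpecies SU3) {Ca Cb : ℝ} (hCa : ∀ U, |A.F U| ≤ Ca) (hCb : ∀ U, |B.F U| ≤ Cb) {t : ℕ}
    (ht : t ≤ S) :
    |∫ U, A.F (torusLift (2 * S + 1) U) *
          B.F (configShift (-Pi.single 0 (t : ℤ)) (torusLift (2 * S + 1) U)) ∂ν -
        (∫ U, A.F (torusLift (2 * S + 1) U) ∂ν) *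
          ∫ U, B.F (configShift (-Pi.single 0 (t : ℤ)) (torusLift (2 * S + 1) U)) ∂ν| ≤
      C₀ * Ca * Cb * A.supp.card * B.supp.card *
        Real.exp (κₑ * (((A.supp.sup fun e => (e.1 0).natAbs) +
          (B.supp.sup fun e => (e.1 0).natAbs) + 2 : ℕ) : ℝ)) *
        Real.exp (-(κₑ / (6 * ℓ₀) * (a * t))) := by
  have hf : Measurable fun U : GaugeConfig 4 (2 * S + 1) SU3 => A.F (torusLift (2 * S + 1) U) :=
    A.measurable.comp (measurable_torusLift _)
  have hg : Measurable fun U : GaugeConfig 4 (2 * S + 1) SU3 =>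
      B.F (configShift (-Pi.single (0 : Fin 4) (t : ℤ)) (torusLift (2 * S + 1) U)) :=
    B.measurable.comp ((configShift _).measurable.comp (measurable_torusLift _))
  have hmain := hcov _ _ _ _ Ca Cb _ hf hg (fun U => hCa _) (fun U => hCb _)
    (dependsOn_comp_torusLift A.isCylinder _)
    (dependsOn_comp_configShift_torusLift B.isCylinder _ _)
    (le_cdist_cellOf_torusEdge_timeShift hb' h2 A.supp B.supp ht)
  refine hmain.trans ?_
  have hCa0 : 0 ≤ Ca := (abs_nonneg _).trans (hCa fun _ => 1)
  have hCb0 : 0 ≤ Cb := (abs_nonneg _).trans (hCb fun _ => 1)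
  have hΔf : ((A.supp.image fun e => cellOf (prodFrame (2 * S + 1) b' μ)
      (torusEdge (2 * S + 1) e)).card : ℝ) ≤ A.supp.card := by
    exact_mod_cast Finset.card_image_le
  have hΔg : ((B.supp.image fun e => cellOf (prodFrame (2 * S + 1) b' μ)
      (torusEdge (2 * S + 1) (e.1 - -Pi.single (0 : Fin 4) (t : ℤ), e.2))).card : ℝ) ≤
      B.supp.card := by
    exact_mod_cast Finset.card_image_le
  have hnum := final_numeric (t := t)
    (δ₀ := (A.supp.sup fun e => (e.1 0).natAbs) + (B.supp.sup fun e => (e.1 0).natAbs))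
    (a := a) hκₑ hℓ₀ hb' h6
  have hK : 0 ≤ C₀ * Ca * Cb := by positivity
  generalize (A.supp.image fun e => cellOf (prodFrame (2 * S + 1) b' μ)
      (torusEdge (2 * S + 1) e)).card = cf at *
  generalize (B.supp.image fun e => cellOf (prodFrame (2 * S + 1) b' μ)
      (torusEdge (2 * S + 1) (e.1 - -Pi.single (0 : Fin 4) (t : ℤ), e.2))).card = cg at *
  generalize t / (2 * b') -
    ((A.supp.sup fun e => (e.1 0).natAbs) + (B.supp.sup fun e => (e.1 0).natAbs) + 1) = D at *
  have hprod := mul_le_mul hΔf hΔg (Nat.cast_nonneg _) (Nat.cast_nonneg _)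
  have hE : 0 ≤ Real.exp (-(κₑ * D)) := (Real.exp_pos _).le
  calc C₀ * Ca * Cb * cf * cg * Real.exp (-(κₑ * D))
      = (C₀ * Ca * Cb) * ((cf : ℝ) * cg) * Real.exp (-(κₑ * D)) := by ring
    _ ≤ (C₀ * Ca * Cb) * ((A.supp.card : ℝ) * B.supp.card) * Real.exp (-(κₑ * D)) :=
        mul_le_mul_of_nonneg_right (mul_le_mul_of_nonneg_left hprod hK) hE
    _ ≤ (C₀ * Ca * Cb) * ((A.supp.card : ℝ) * B.supp.card) *
        (Real.exp (κₑ * (((A.supp.sup fun e => (e.1 0).natAbs) +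
          (B.supp.sup fun e => (e.1 0).natAbs) + 2 : ℕ) : ℝ)) *
          Real.exp (-(κₑ / (6 * ℓ₀) * (a * t)))) :=
        mul_le_mul_of_nonneg_left hnum (by positivity)
    _ = _ := by ring

/-- **`stub_deployment` (CLOSED)**: toolkit + engine + certificate give uniform IR clustering of the
translation-invariant sup-small range-controlled cone, for every `κ > 0`. Constants: `c₁ = c₁(p₀(n))`
of the certificate; `η₁ = min(ε₁/(2·10⁴), log(1+Λ₀)/(4·10⁴(4n+1)⁴))`; `Δ = κₑ/(6ℓ₀)`; frames of scale
`⌈2ℓ₀/a_k⌉`. -/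
theorem stub_deployment : Deployment := by
  rintro ⟨-, -, hDLR⟩ hE ⟨n, hn, hcert⟩
  obtain ⟨p₀, ε₁, hp₀, hε₁, heng⟩ := hE n hn
  obtain ⟨ε₀, c₁, hε₀, hshell, hc₁, hcert⟩ := hcert p₀ hp₀
  refine ⟨c₁, hc₁, fun κ hκ => ?_⟩
  obtain ⟨Λ₀, κₑ, C₀, hΛ₀, hκₑ, hC₀, hEng⟩ := heng ε₀ κ hε₀ hshell hκ
  obtain ⟨X, hX⟩ : ∃ X : ℝ, X = 4 * (10 ^ 4 * (4 * (n : ℝ) + 1) ^ 4) := ⟨_, rfl⟩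
  have hXpos : 0 < X := by rw [hX]; positivity
  obtain ⟨η₁, hη₁⟩ : ∃ η₁ : ℝ, η₁ = min (ε₁ / (2 * 10 ^ 4)) (Real.log (1 + Λ₀) / X) := ⟨_, rfl⟩
  have hη₁pos : 0 < η₁ := by
    rw [hη₁]; exact lt_min (by positivity) (div_pos (Real.log_pos (by linarith)) hXpos)
  have hηε : 2 * η₁ * 10 ^ 4 ≤ ε₁ := by
    have h' : η₁ ≤ ε₁ / (2 * 10 ^ 4) := hη₁ ▸ min_le_left _ _
    rw [le_div_iff₀ (by positivity)] at h'; linarith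
  have hηΛ : Real.exp (4 * η₁ * (10 ^ 4 * (4 * n + 1) ^ 4)) - 1 ≤ Λ₀ := by
    have h1 : η₁ ≤ Real.log (1 + Λ₀) / X := hη₁ ▸ min_le_right _ _
    rw [le_div_iff₀ hXpos] at h1
    have h2 : 4 * η₁ * (10 ^ 4 * (4 * (n : ℝ) + 1) ^ 4) = η₁ * X := by rw [hX]; ring
    rw [h2, sub_le_iff_le_add]
    calc Real.exp (η₁ * X) ≤ Real.exp (Real.log (1 + Λ₀)) := Real.exp_le_exp.2 h1
      _ = 1 + Λ₀ := Real.exp_log (by linarith)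
      _ = Λ₀ + 1 := add_comm _ _
  have hΛl : (0 : ℝ) ≤ Real.exp (4 * η₁ * (10 ^ 4 * (4 * n + 1) ^ 4)) - 1 :=
    sub_nonneg.2 (Real.one_le_exp (by positivity))
  refine ⟨η₁, hη₁pos, ?_⟩
  intro a L ha ha₀ haL β' Λ' hΛ' hβ ℓ₀ hℓ₀
  have hℓ₀pos : 0 < ℓ₀ := pos_of_mul_pos_right (hc₁.trans_le hℓ₀) hΛ'.le
  refine ⟨κₑ / (6 * ℓ₀), by positivity, fun A B => ?_⟩
  obtain ⟨Ca, hCa⟩ := A.bounded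
  obtain ⟨Cb, hCb⟩ := B.bounded
  refine ⟨C₀ * Ca * Cb * A.supp.card * B.supp.card *
    Real.exp (κₑ * (((A.supp.sup fun e => (e.1 0).natAbs) +
      (B.supp.sup fun e => (e.1 0).natAbs) + 2 : ℕ) : ℝ)), ?_⟩
  have hev1 : ∀ᶠ k in atTop, a k ≤ min 1 ℓ₀ := ha₀.eventually_le_const (lt_min one_pos hℓ₀pos)
  have hev2 : ∀ᶠ k in atTop, (4 * (n : ℝ) + 3) * (2 * ℓ₀ + 1) ≤ a k * L k :=
    haL.eventually_ge_atTop _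
  have hev3 := hcert a ha ha₀ β' Λ' hΛ' hβ (2 * (Λ' * ℓ₀)) (by linarith)
  filter_upwards [hev1, hev2, hev3] with k hk1 hk2 hk3
  intro S hS w hw hrc hinv t ht
  obtain ⟨hb, hb', hbb, h2b, h1, h2, hμ, h6⟩ := level_numerics (n := n) (ha k)
    (hk1.trans (min_le_left _ _)) (hk1.trans (min_le_right _ _)) hk2 hS
  set b' := ⌈2 * ℓ₀ / a k⌉₊ with hb'def
  set μ := (2 * S + 1) / b' - 1 with hμdef
  have hCeq : ⌈2 * (Λ' * ℓ₀) / (Λ' * a k)⌉₊ = b' := by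
    rw [hb'def]; congr 1; field_simp
  obtain ⟨good, hFS, hPR⟩ := hk3 S (fun _ => μ) (prodFrame (2 * S + 1) b' μ) (fun _ => hμ)
    (fun _ => by rw [hCeq]; exact isTorusFrame_axisFrame hb' h1 h2)
  -- DLR inputs (toolkit (c)), local a.c. and leak profiles (toolkit (a), (b) through cells)
  have hρ : Continuous ρ₃ := continuous_fundamentalRep _
  obtain ⟨hspw, hgw⟩ := hDLR SU3 3 ρ₃ hρ (2 * S + 1) _ (β' k) w
  obtain ⟨hsp0, hg0⟩ := hDLR SU3 3 ρ₃ hρ (2 * S + 1) 1 (β' k) 0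
  rw [QuasiLocalGaugePerturbation.perturbedMeasure_zero] at hg0
  have hK : ∀ A : Finset (Edge 4 (2 * S + 1)),
      ((A.image fun e => blockCorner ⌊ℓ₀ / a k⌋₊ e.1).card : ℝ) ≤
        10 ^ 4 * cellCount (cellOf (prodFrame (2 * S + 1) b' μ)) A := fun A => by
    exact_mod_cast card_image_blockCorner_le_mul_cellCount (μ := μ) hb hb' hbb h2 A
  have hcon := cdist_cellOf_le_of_blockCorner_near (d := 4) (μ := μ) hb hb' h2b h1
  have hAC' : IsLocallyAC (cellOf (prodFrame (2 * S + 1) b' μ)) (spec ρ₃ (β' k) w)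
      (wilsonSpec ρ₃ (β' k)) ε₁ :=
    QuasiLocalGaugePerturbation.isLocallyAC_kernel_of_card_le ρ₃ hρ _ hK (β' k) hκ.le hη₁pos.le hηε
      w hw
  have hLw : HasLeak (cellOf (prodFrame (2 * S + 1) b' μ)) (spec ρ₃ (β' k) w) n
      (Real.exp (4 * η₁ * (10 ^ 4 * (4 * n + 1) ^ 4)) - 1) κ :=
    QuasiLocalGaugePerturbation.hasLeak_kernel_of_card_le ρ₃ hρ hb _ (by norm_num) hK hcon (β' k) hκ.le
      n w hw hrc
  have hL0 : HasLeak (cellOf (prodFrame (2 * S + 1) b' μ)) (wilsonSpec ρ₃ (β' k)) n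
      (Real.exp (4 * η₁ * (10 ^ 4 * (4 * n + 1) ^ 4)) - 1) κ :=
    QuasiLocalGaugePerturbation.hasLeak_kernel_zero ρ₃ hρ hb _ (by norm_num) hK hcon (β' k) hκ.le n hΛl
  -- the engine at this level, for the covariance; (h1) turns `connectedCorr` into the covariance
  rw [w.connectedCorr_eq_covCorr ρ₃ (β' k) hinv, w.covCorr_eq_integral]
  exact level_bound hb' h2 hκₑ hC₀ hℓ₀pos h6 _
    (hEng (fun _ => μ) (Edge 4 (2 * S + 1)) SU3 (cellOf (prodFrame (2 * S + 1) b' μ))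
      (wilsonSpec ρ₃ (β' k)) (spec ρ₃ (β' k) w) good (wilsonMeasure ρ₃ (β' k))
      (w.perturbedMeasure ρ₃ (β' k)) p₀ _ (fun _ => hμ) hsp0 hspw hg0 hgw hFS hΛl hηΛ hL0 hLw hAC'
      hp₀.le le_rfl hPR)
    A B hCa hCb ht

end Proof

end Summit.QuantumFields.QCD.Cruxes.RobustYangMills.LocalAcOpenCertificate

end
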